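import Literature.Geometry.Symplectic.MinimalSymplecticFourBPlusOne
import Literature.AlgebraicTopology.SingularHomology.EulerCharacteristicTriple
import HarnessLib
import HarnessLib.Audit

/-!
# Gompf's question and Li's symplectic BMY conjecture as obligation nodes — CHOICE-FREE,
SIGN-CALIBRATED and CORRECTED statements (crux `NoGenusTwoDoor`, stmt-SmoothPoincare4-7842)

This file supersedes the two obligation nodes of `Theorems/GompfEulerCharacteristicQuestion.lean`
(`GompfEulerCharacteristicQuestion`, `LiSymplecticBMYConjecture`, landed 2026-08-17 09:54Z), which
are MISSTATED AS TYPED on two counts: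

1. **Sign.** They read minimality, `K · [ω]` and `K · K` through `IsMinimal s`,
   `canonicalClassDotOmega s`, `canonicalClassSq s` of `MinimalSymplecticFourBPlusOne.lean`, i.e.
   against the constructive orientation `symplecticOrientation s`, whose sign relative to the
   symplectic orientation of the books is the bare `Classical.choice` `ε_dR ∈ {±1}` (verdict
   clean-up of that file, 2026-08-17 11:32Z: `one_le_bPlus ↔ ε_dR = 1`,
   `canonicalClassDotOmega_eq_or_eq_neg`; the named facts `one_le_bPlus` and
   `liu1996_complexProjectivePlane_of_rank_two_eq_one` on which the derivation of the crux from
   those nodes rested are deprecated as misstated).  Here, following the discipline of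
   `liu1996_complexProjectivePlane_of_rank_two_eq_one_calibrated`, everything is read against THE
   symplectic orientation `μ` (`μ.IsSymplecticOrientationOf s hs hcl`: `0 < ⟨[s] ⌣ [s], [N]_μ⟩`),
   the canonical class is `ε • K_J = -ε • c₁(TN, J)` for ANY `s`-compatible `J` and a Chern sign
   `ε ∈ {±1}` calibrated by Gauss–Bonnet on `2`-spheres (`IsCalibratedChernSign ε`), `K · [ω]` is
   `classDotOmega μ (ε • K_J) s`, `K · K` is `⟨K_J ⌣ K_J, [N]_μ⟩` (even in `ε`), and minimality is
   spelled out over `μ`: no smoothly embedded `s`-symplectic `2`-sphere whose `μ`-Poincaré dual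
   class has square `-1`.
2. **The `K · K ≥ 0` clause.** `GompfEulerCharacteristicQuestion` rendered "neither rational nor
   ruled" as "`K · [ω] ≥ 0`", after McDuff–Salamon 2017, Rem. 13.3.28 (ii) ("a minimal closed
   symplectic four-manifold is rational or ruled if and only if `K · [ω] < 0`").  The "only if" of
   that remark fails for ruled surfaces over a base of genus `g ≥ 2` with large fibres: on
   `Σ_g × S²` with the product form of base area `A` and fibre area `B`,
   `K · [ω] = (2g - 2) B - 2 A`, which is `≥ 0` as soon as `(g - 1) B ≥ A`, while `χ = 4 - 4g < 0` —
   so that node is FALSE as a statement (counterexample `Σ₂ × S²`, `B ≥ A`), whatever the sign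
   conventions.  The printed notion is the symplectic Kodaira dimension (McDuff–Salamon 2017,
   eq. (13.4.9); T.-J. Li 2006, Def. 2.2): for minimal `(M, ω)`, `κ = -∞` iff `K · K < 0` OR
   `K · [ω] < 0` — the genus-`≥ 2` ruled surfaces being caught by `K · K = 8(1 - g) < 0` — and
   "`κ = -∞` iff (a blow-up of) `ℂP²` or a ruled surface" (McDuff–Salamon 2017, p. 563, after
   (13.4.9); Liu 1996 Thms. A, B for `⇒`).  So Gompf's question for minimal manifolds is
   "`K · [ω] ≥ 0 ∧ K · K ≥ 0 ⇒ χ ≥ 0`", with BOTH clauses; this file states it so.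

Registered open statements (CONVENTIONS §4; obligation nodes, no `_holds` expected), parametrised
by the Chern sign exactly like the calibrated Liu fact — for the calibrated `ε` each is the printed
statement verbatim, for `-ε` its calibration premise fails and it is vacuous, so the printed
conjecture is `∀ ε, …Calibrated ε` and is never stronger than print:

* `GompfEulerCharacteristicQuestionCalibrated ε` — Gompf's question (Kotschick, PAMS 134 (2006),
  arXiv p. 3: "Gompf asked whether a non-ruled symplectic `4`-manifold necessarily has
  non-negative Euler characteristic. This question is still open.") for MINIMAL manifolds in
  Kodaira form: `μ`-minimal, `K · [ω] ≥ 0`, `K · K ≥ 0` ⇒ `χ ≥ 0`; i.e. T.-J. Li's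
  "`κˢ ≥ 0 ⇒ χ ≥ 0`" (arXiv:1511.04831 §4.3.1: a theorem for `κˢ = 0`, Conj. 4.9 for `κˢ = 1`,
  the `χ`-part of the BMY Conj. 4.11 for `κˢ = 2`).
  -- TODO(general form): the printed question also covers non-minimal manifolds (blow-ups are not
  -- typed in the tree).
* `LiSymplecticBMYConjectureCalibrated ε` — Li's Conj. 4.11 (§4.4.1: "`κˢ = 2` manifolds satisfy the
  Bogomolov–Miyaoka–Yau inequality `K_ω · K_ω ≤ 3χ(M)`") for minimal `κˢ = 2` manifolds
  (`K · [ω] > 0`, `K · K > 0`).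

The crux `NoGenusTwoDoor` follows from either node, modulo printed theorems only (Hirzebruch's
`c₁² = 2χ + 3σ`, Liu's calibrated `b₂ = 1` theorem, the Chern-sign calibration):
`Theorems/SymplecticOrigamiNoGenusTwoDoorCalibratedBridge.lean`.

Sources: D. Kotschick, PAMS 134 (2006) 3081–3083, arXiv:math/0504578 p. 3 [Kotschick2006];
T.-J. Li, arXiv:1511.04831 §4.3.1 Conj. 4.9, §4.4.1 Conj. 4.11 [LiKodairaLowDim2015]; T.-J. Li, JDG 74
(2006) Def. 2.2 [Li2006]; D. McDuff, D. Salamon (2017), Rem. 13.3.28, eq. (13.4.9) and p. 563,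
Thm. 2.7.1, Def. 4.1.4 [McDuffSalamon2017]; A.-K. Liu, MRL 3 (1996) Thms. A, B [Liu1996].
-/

noncomputable section

-- the prescribed namespace `Summit.<P>.<Sub>.…` duplicates `SmoothPoincare4` (P = Sub)
set_option linter.dupNamespace false

open scoped Manifold ContDiff Topology ContinuousMap
open Literature.Geometry.Kaehler (MForm IsSmoothForm IsClosedForm)
open Literature.AlgebraicTopology.SingularHomology
open Literature.Geometry.Symplectic

namespace Summit.SmoothPoincare4.SmoothPoincare4.Theorems

/-- OPEN CONJECTURE — **Gompf's question on the Euler characteristic of non-ruled symplectic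
`4`-manifolds**, minimal manifolds, Kodaira form, CHOICE-FREE and SIGN-CALIBRATED (supersedes
`GompfEulerCharacteristicQuestion`, misstated as typed — module docstring).  Posed by Gompf (1995),
recorded open by Kotschick, PAMS 134 (2006), arXiv p. 3: "Gompf asked whether a non-ruled
symplectic `4`-manifold necessarily has non-negative Euler characteristic. This question is still
open." [cite: Kotschick2006, p. 3 (arXiv:math/0504578), after the proof of Thm. 2 — question posed by Gompf1995, recorded open]
Typed, for a Chern sign `ε ∈ {±1}` and granted its calibration against the literature
(`IsCalibratedChernSign ε`: `⟨ε c₁(TS²), [S²]⟩ = 2` on de Rham-positively oriented symplectic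
spheres, McDuff–Salamon Thm. 2.7.1), as: for every closed connected `4`-manifold `N`, smooth closed
`2`-form `s`, ITS symplectic orientation `μ` (`0 < ⟨[s] ⌣ [s], [N]_μ⟩`) and `s`-compatible almost
complex structure `J` (so `s` is symplectic and `K = ε • K_J = -ε • c₁(TN, J)` is the canonical
class of the books, McDuff–Salamon Def. 4.1.4), IF `(N, s)` is minimal — no smooth embedding
`b : S² → N`, symplectic for `s`, whose `μ`-Poincaré-dual class `σ` (`σ ⌢ [N]_μ = b_*[S²]`) has
`⟨σ ⌣ σ, [N]_μ⟩ = -1` — and of symplectic Kodaira dimension `κ ≠ -∞`, i.e. `K · [ω] ≥ 0` AND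
`K · K ≥ 0` (McDuff–Salamon 2017, eq. (13.4.9): for minimal `(M, ω)`, "`κ = -∞` if `K² < 0` or
`K · [ω] < 0`"; and p. 563: "`κ = -∞` if and only if it is a blowup of the complex projective plane
or of a ruled surface", so this hypothesis says "minimal, neither rational nor ruled", the minimal
rational ones having `χ ≥ 3` anyway) [cite: McDuffSalamon2017, eq. (13.4.9) and p. 563; Rem. 13.3.28; Thm. 2.7.1; Def. 4.1.4],
THEN `0 ≤ χ(N) = relEuler ℤ ℤ N ∅`.  Both clauses are needed: `Σ_g × S²` (`g ≥ 2`) with a product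
form of fibre area `≥ (g - 1)⁻¹ ×` base area is minimal with `K · [ω] ≥ 0`, `K · K = 8 - 8g < 0`,
`χ < 0`.  In T.-J. Li's language this is "`κˢ ≥ 0 ⇒ χ ≥ 0`": his theorem for `κˢ = 0`, Conj. 4.9
for `κˢ = 1`, the `χ`-part of Conj. 4.11 for `κˢ = 2` [cite: LiKodairaLowDim2015, §4.3.1 Conj. 4.9; §4.4.1 Conj. 4.11] [cite: Li2006, Def. 2.2].
For the calibrated `ε` this is the printed question verbatim (minimal case); for `-ε` the premise
fails and the def is vacuous; the printed conjecture is `∀ ε, GompfEulerCharacteristicQuestionCalibrated ε`.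
-- TODO(general form): non-minimal manifolds ("not a blow-up of a ruled surface ⇒ χ ≥ 0").
Registered open statement (CONVENTIONS §4): take `(h : GompfEulerCharacteristicQuestionCalibrated ε)`
with `(hε : IsCalibratedChernSign ε)`; no `_holds` is expected short of solving the problem.
Smallest open case: `b⁺ = 1`, where a counterexample is exactly a door (T.-J. Li, §4.3.1).
[status: open] -/
@[conjecture] def GompfEulerCharacteristicQuestionCalibrated (ε : ℤˣ) : Prop :=
  IsCalibratedChernSign ε →
    ∀ (N : Type) [TopologicalSpace N] [T2Space N] [SecondCountableTopology N] [CompactSpace N]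
      [ConnectedSpace N] [ChartedSpace (EuclideanSpace ℝ (Fin 4)) N] [IsManifold (𝓡 4) ∞ N]
      (s : MForm (𝓡 4) N ℝ 2) (hs : IsSmoothForm s) (hcl : IsClosedForm s)
      (μ : HomologicalOrientation ℤ N 4), μ.IsSymplecticOrientationOf s hs hcl →
      ∀ J : AlmostComplexStructure (𝓡 4) ∞ N, J.IsCompatibleWith s →
      (∀ (b : Metric.sphere (0 : EuclideanSpace ℝ (Fin 3)) 1 → N)
        (hb : Manifold.IsSmoothEmbedding (𝓡 2) (𝓡 4) ∞ b),
        (∀ y (v : TangentSpace (𝓡 2) y), v ≠ 0 → ∃ w : TangentSpace (𝓡 2) y,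
          s (b y) ![mfderiv (𝓡 2) (𝓡 4) b y v, mfderiv (𝓡 2) (𝓡 4) b y w] ≠ 0) →
        ∀ (μS : HomologicalOrientation ℤ (Metric.sphere (0 : EuclideanSpace ℝ (Fin 3)) 1) 2)
          (σ : singularCohomology ℤ ℤ N 2),
          poincareDualityMap μ two_add_two_eq_four σ =
            singularHomology.map ℤ ℤ ⟨b, hb.isEmbedding.continuous⟩ 2 μS.fundamentalClass →
          cupPairing μ two_add_two_eq_four σ σ ≠ -1) →
      0 ≤ classDotOmega μ ((ε : ℤ) • J.canonicalClass) s hs hcl →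
      0 ≤ cupPairing μ two_add_two_eq_four J.canonicalClass J.canonicalClass →
      0 ≤ relEuler ℤ ℤ N ∅

/-- OPEN CONJECTURE — **the symplectic Bogomolov–Miyaoka–Yau inequality** (T.-J. Li,
arXiv:1511.04831 §4.4.1: "The basic conjecture is **Conjecture 4.11.** `κˢ = 2` manifolds satisfy
the Bogomolov–Miyaoka–Yau inequality `K_ω · K_ω ≤ 3χ(M)`.") [cite: LiKodairaLowDim2015, §4.4.1 Conj. 4.11],
CHOICE-FREE and SIGN-CALIBRATED (supersedes `LiSymplecticBMYConjecture`, read against the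
choice-dependent orientation — module docstring).  Typed, for a Chern sign `ε` granted
`IsCalibratedChernSign ε`, over THE symplectic orientation `μ` of `(N, s)` and any `s`-compatible
`J` (`K = ε • K_J`), for MINIMAL manifolds (same spelling as in
`GompfEulerCharacteristicQuestionCalibrated`) of symplectic Kodaira dimension `2` — `K · [ω] > 0` and
`K · K > 0` (McDuff–Salamon 2017, eq. (13.4.9); T.-J. Li 2006, Def. 2.2) [cite: McDuffSalamon2017, eq. (13.4.9); Thm. 2.7.1; Def. 4.1.4] [cite: Li2006, Def. 2.2] —
concluding `K · K ≤ 3 χ(N)`, `χ(N) = relEuler ℤ ℤ N ∅`.  (The `κˢ = 2` geography refers to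
minimal manifolds: Li, §4.4.1, "realized as `(χ(M), K_ω · K_ω)` for some minimal symplectic
4-manifold".)  For the calibrated `ε` this is Conj. 4.11 verbatim, for `-ε` it is vacuous; the
printed conjecture is `∀ ε, LiSymplecticBMYConjectureCalibrated ε`.  Registered open statement
(CONVENTIONS §4). [status: open] -/
@[conjecture] def LiSymplecticBMYConjectureCalibrated (ε : ℤˣ) : Prop :=
  IsCalibratedChernSign ε →
    ∀ (N : Type) [TopologicalSpace N] [T2Space N] [SecondCountableTopology N] [CompactSpace N]
      [ConnectedSpace N] [ChartedSpace (EuclideanSpace ℝ (Fin 4)) N] [IsManifold (𝓡 4) ∞ N]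
      (s : MForm (𝓡 4) N ℝ 2) (hs : IsSmoothForm s) (hcl : IsClosedForm s)
      (μ : HomologicalOrientation ℤ N 4), μ.IsSymplecticOrientationOf s hs hcl →
      ∀ J : AlmostComplexStructure (𝓡 4) ∞ N, J.IsCompatibleWith s →
      (∀ (b : Metric.sphere (0 : EuclideanSpace ℝ (Fin 3)) 1 → N)
        (hb : Manifold.IsSmoothEmbedding (𝓡 2) (𝓡 4) ∞ b),
        (∀ y (v : TangentSpace (𝓡 2) y), v ≠ 0 → ∃ w : TangentSpace (𝓡 2) y,
          s (b y) ![mfderiv (𝓡 2) (𝓡 4) b y v, mfderiv (𝓡 2) (𝓡 4) b y w] ≠ 0) →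
        ∀ (μS : HomologicalOrientation ℤ (Metric.sphere (0 : EuclideanSpace ℝ (Fin 3)) 1) 2)
          (σ : singularCohomology ℤ ℤ N 2),
          poincareDualityMap μ two_add_two_eq_four σ =
            singularHomology.map ℤ ℤ ⟨b, hb.isEmbedding.continuous⟩ 2 μS.fundamentalClass →
          cupPairing μ two_add_two_eq_four σ σ ≠ -1) →
      0 < classDotOmega μ ((ε : ℤ) • J.canonicalClass) s hs hcl →
      0 < cupPairing μ two_add_two_eq_four J.canonicalClass J.canonicalClass →
      cupPairing μ two_add_two_eq_four J.canonicalClass J.canonicalClass ≤ 3 * relEuler ℤ ℤ N ∅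

/-- **BMY gives the `κˢ = 2` share of Gompf's question** (calibrated forms): under
`LiSymplecticBMYConjectureCalibrated ε` and `IsCalibratedChernSign ε`, a minimal `(N, s)` with
`K · [ω] > 0` and `K · K > 0` has `χ > 0` (`0 < K · K ≤ 3χ`; T.-J. Li, §4.4.1: "Conjecture
(Euler) for minimal `κˢ = 1` manifolds fits with Conjecture (conj-bmy)").
[cite: LiKodairaLowDim2015, §4.4.1 (remark after Conj. 4.11)] -/
theorem relEuler_pos_of_liSymplecticBMYCalibrated {ε : ℤˣ} (h : LiSymplecticBMYConjectureCalibrated ε)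
    (hε : IsCalibratedChernSign ε)
    {N : Type} [TopologicalSpace N] [T2Space N] [SecondCountableTopology N] [CompactSpace N]
    [ConnectedSpace N] [ChartedSpace (EuclideanSpace ℝ (Fin 4)) N] [IsManifold (𝓡 4) ∞ N]
    (s : MForm (𝓡 4) N ℝ 2) (hs : IsSmoothForm s) (hcl : IsClosedForm s)
    {μ : HomologicalOrientation ℤ N 4} (hμ : μ.IsSymplecticOrientationOf s hs hcl)
    {J : AlmostComplexStructure (𝓡 4) ∞ N} (hJ : J.IsCompatibleWith s)
    (hmin : ∀ (b : Metric.sphere (0 : EuclideanSpace ℝ (Fin 3)) 1 → N)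
        (hb : Manifold.IsSmoothEmbedding (𝓡 2) (𝓡 4) ∞ b),
        (∀ y (v : TangentSpace (𝓡 2) y), v ≠ 0 → ∃ w : TangentSpace (𝓡 2) y,
          s (b y) ![mfderiv (𝓡 2) (𝓡 4) b y v, mfderiv (𝓡 2) (𝓡 4) b y w] ≠ 0) →
        ∀ (μS : HomologicalOrientation ℤ (Metric.sphere (0 : EuclideanSpace ℝ (Fin 3)) 1) 2)
          (σ : singularCohomology ℤ ℤ N 2),
          poincareDualityMap μ two_add_two_eq_four σ =
            singularHomology.map ℤ ℤ ⟨b, hb.isEmbedding.continuous⟩ 2 μS.fundamentalClass →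
          cupPairing μ two_add_two_eq_four σ σ ≠ -1)
    (hKω : 0 < classDotOmega μ ((ε : ℤ) • J.canonicalClass) s hs hcl)
    (hKK : 0 < cupPairing μ two_add_two_eq_four J.canonicalClass J.canonicalClass) :
    0 < relEuler ℤ ℤ N ∅ := by
  have h3 := h hε N s hs hcl μ hμ J hJ hmin hKω hKK
  omega

/-- **Registered sub-goal `stub_relEuler_pos_of_liSymplecticBMYCalibrated` of the crux item**
(one-line form of `relEuler_pos_of_liSymplecticBMYCalibrated`: the calibrated BMY node gives
`χ > 0` for minimal `κˢ = 2` manifolds — the `κˢ = 2` share of Gompf's question, which the door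
would violate). [cite: LiKodairaLowDim2015, §4.4.1 (remark after Conj. 4.11)] -/
theorem stub_relEuler_pos_of_liSymplecticBMYCalibrated : ∀ (ε : ℤˣ), Summit.SmoothPoincare4.SmoothPoincare4.Theorems.LiSymplecticBMYConjectureCalibrated ε → Literature.Geometry.Symplectic.IsCalibratedChernSign ε → ∀ (N : Type) [TopologicalSpace N] [T2Space N] [SecondCountableTopology N] [CompactSpace N] [ConnectedSpace N] [ChartedSpace (EuclideanSpace ℝ (Fin 4)) N] [IsManifold (𝓡 4) ∞ N] (s : Literature.Geometry.Kaehler.MForm (𝓡 4) N ℝ 2) (hs : Literature.Geometry.Kaehler.IsSmoothForm s) (hcl : Literature.Geometry.Kaehler.IsClosedForm s) (μ : Literature.AlgebraicTopology.SingularHomology.HomologicalOrientation ℤ N 4), μ.IsSymplecticOrientationOf s hs hcl → ∀ (J : Literature.Geometry.Symplectic.AlmostComplexStructure (𝓡 4) ∞ N), J.IsCompatibleWith s → (∀ (b : ↥(Metric.sphere (0 : EuclideanSpace ℝ (Fin 3)) 1) → N) (hb : Manifold.IsSmoothEmbedding (𝓡 2) (𝓡 4) ∞ b), (∀ y (v :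 TangentSpace (𝓡 2) y), v ≠ 0 → ∃ w : TangentSpace (𝓡 2) y, s (b y) ![mfderiv (𝓡 2) (𝓡 4) b y v, mfderiv (𝓡 2) (𝓡 4) b y w] ≠ 0) → ∀ (μS : Literature.AlgebraicTopology.SingularHomology.HomologicalOrientation ℤ ↥(Metric.sphere (0 : EuclideanSpace ℝ (Fin 3)) 1) 2) (σ : Literature.AlgebraicTopology.SingularHomology.singularCohomology ℤ ℤ N 2), Literature.AlgebraicTopology.SingularHomology.poincareDualityMap μ two_add_two_eq_four σ = Literature.AlgebraicTopology.SingularHomology.singularHomology.map ℤ ℤ ⟨b, hb.isEmbedding.continuous⟩ 2 μS.fundamentalClass → Literature.AlgebraicTopology.SingularHomology.cupPairing μ two_add_two_eq_four σ σ ≠ -1) → 0 < Literature.Geometry.Symplectic.classDotOmega μ ((ε : ℤ) • J.canonicalClass) s hs hcl → 0 < Literature.AlgebraicTopology.SingularHomology.cupPairing μ two_add_two_eq_four J.canonicalClass J.canonicalClass → 0 < Literature.AlgebraicTopology.SingularHomology.relEuler ℤ ℤ N ∅ :=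
  fun _ε h hε _ _ _ _ _ _ _ _ s hs hcl _μ hμ _J hJ hmin hKω hKK =>
    relEuler_pos_of_liSymplecticBMYCalibrated h hε s hs hcl hμ hJ hmin hKω hKK

end Summit.SmoothPoincare4.SmoothPoincare4.Theorems

end
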